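import Summits.AnomalousDissipation.AnomalousDissipation.Theorems.MirrorVarietyFixedViscosityTransfer
import Summits.AnomalousDissipation.AnomalousDissipation.Theorems.MirrorVarietySteadyWeakIsGlobalLerayHopf

/-!
# Route MirrorVariety — `Assembly` (stmt-AnomalousDissipation-2993)

`GalerkinSteadyZerothLaw → AnomalousDissipation` (= `Literature.Turb.ZerothLaw`): the route's
kernel-checked deciding theorem `MirrorVariety.closes` takes the thesis together with the two
supports `FixedViscosityTransfer` (stmt-2991, `FixedViscosityTransfer_proof`: Temam 1979 Ch. II
Thm 1.2 (ii) on the given Galerkin zeros) and `SteadyWeakIsGlobalLerayHopf` (stmt-2992,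
`steadyWeakIsGlobalLerayHopf_proof`: the constant path of a steady weak solution in `V` with the
energy equation is a global Leray–Hopf solution whose long-time means are `∫ |u|²` and
`ν ‖∇u‖²`); both are proved in this directory, so the assembly is their composition.
-/

-- `Summit.<Summit>.<Problem>` is the tree's mandated summit-side namespace (CONVENTIONS §2); for this
-- single-conjunct summit the two coincide, so the duplicate is deliberate.
set_option linter.dupNamespace false

namespace Summit.AnomalousDissipation.AnomalousDissipation.Theorems

/-- **Route decl `Assembly` (stmt-AnomalousDissipation-2993), proved**: the Galerkin steady
zeroth law implies `AnomalousDissipation`, by the route's deciding theorem `closes` fed with the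
proved supports `FixedViscosityTransfer_proof` and `steadyWeakIsGlobalLerayHopf_proof`
(for each `j`: transfer the loud bounded Galerkin states at `ν_j` to a loud bounded steady weak
solution `u_j ∈ V` with the energy equation, then take the constant path `t ↦ u_j` as the global
Leray–Hopf solution from `u_j`; `meanEnergy = ∫ |u_j|² ≤ E`, `meanDissipation = ν_j ‖∇u_j‖² ≥ ε`).
[folklore] -/
theorem assembly_proof :
    Summit.AnomalousDissipation.AnomalousDissipation.Theses.MirrorVariety.Assembly :=
  fun hX => Summit.AnomalousDissipation.AnomalousDissipation.Theses.MirrorVariety.closes hX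
    FixedViscosityTransfer_proof steadyWeakIsGlobalLerayHopf_proof

end Summit.AnomalousDissipation.AnomalousDissipation.Theorems
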